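import Literature.MathematicalPhysics.QuantumFieldTheory.Balaban1983to89.B9Eq347G1kPiSupGradGlobal
import Literature.MathematicalPhysics.QuantumFieldTheory.Balaban1983to89.B11Eq117TransformationNormComp

/-!
# `Balaban1983to89.B11Eq117GtildeTransformationNorm` — T. Bałaban, *The variational problem and background fields in renormalization group method for
# lattice gauge theories*, Commun. Math. Phys. **102** (1985) 277–309 [Balaban1985Variational] (117) p. 295 *«By Theorem 3.13 of [5] the norm max{|·|_{(−1)},
# |∇·|_{(−2)}} of the transformation can be estimated by B₀|J|_{(−3)} + …»* with [5] = [Balaban1985BackgroundPropagators] Thm 3.13 p. 426, (3.130) p. 421: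
# **THE (117) SOCKET FED ON THE MODEL FOR THE FIRST WORD OF `𝔊̃_k` — print's `G̃_k = Δ̃_{a,k}(U)⁻¹` READ AS A TRANSFORMATION `|·|_(−3) → (115)`:
# `‖toCLM115 ∇_U G̃_k‖ ≤ max(w̄₀·B, w̄₁·B)·w̲⁻¹` with ONE height-free `B`** — this lineage's socket `B11Eq117TransformationNormComp.norm_toCLM115_le_of_comp` (gen 96)
# applied to the globals `B9Eq347G1kPiSupGradGlobal.exists_global_rows_G1kPi` (gen 97): the value row gives `M_T`, the COVARIANT-GRADIENT row gives `M_{∇T}`,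
# both `= B`; the weights' extrema `w̄₀, w̄₁, w̲⁻¹` of (115) stay symbolic (at the tower's top level they are one number each)

statement-level skeleton of published theorems with citation tags; proofs where landed; nothing here is a claim about the Yang–Mills mass gap

CITATION HEADER (lean-in-tree rule).  Audit cell `pub-balaban`, sub-cell `t4`, BINDER row NE9; filed by the NE9 BINDER-row OWNER lineage `b2b-balaban-t4-ne9-p1`
(gen 97; ruling R-ne9p1-g97-4 (2)(d) «the socket = OWNER»; memo `t4/b2b-balaban-t4-ne9-p1/g97/PLAN-V16-SEED.md` §6 (V-117)).  Source READ first-hand in the held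
texts: [Balaban1985Variational] p. 294 (115), p. 295 (116)–(118) (`paper:balaban1985-cmp102-variational-background`, journal page = PDF page + 276);
[Balaban1985BackgroundPropagators] p. 421 (3.130), p. 426 Thm 3.13.  COMPOSED BY NAME: `norm_toCLM115_le_of_comp` and `exists_global_rows_G1kPi` (both this
lineage); Mathlib's `pi_norm_le_iff_of_nonneg`, `norm_le_pi_norm`.

WHAT IS PROVED (sorry-free; proof lane — 0 `def`; [folklore] bookkeeping).  **`exists_norm_toCLM115_G1kPi_le`** — `∃ α₁ B, 0 < α₁ ∧ 0 ≤ B ∧ ∀ ⟨the binder block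
of `exists_global_rows_G1kPi` VERBATIM through `hJ`⟩ (Lw ηw : ℝ) [Fact (0 < Lw)] [Fact (0 < ηw)] (lev₀ : bonds → ℕ) (lev₁ : bonds × Fin d → ℕ),
‖toCLM115 (L := Lw) (η := ηw) (lev₀ := lev₀) lev₁ (∇_U) (G̃_k read on plain bond functions)‖ ≤ max(w̄₀·B, w̄₁·B)·w̲⁻¹` where `∇_U = B9Eq33CovDerivVector.covGrad η⁻¹
(Ad U)`, `G̃_k = G1LatticeK hposπ` read through `WL2.linearEquiv`, `w̄₀ = wSup (levWeight Lw ηw lev₀ 1)`, `w̄₁ = wSup (levWeight Lw ηw lev₁ 2)`, `w̲⁻¹ = wInvSup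
(levWeight Lw ηw lev₀ 3)`.  The two socket letters: `‖G̃_kg‖_∞ ≤ B‖g‖_∞` (conjunct 1 of the globals at `M := ‖g‖_∞`) and `‖∇_U(G̃_kg)‖_∞ ≤ B‖g‖_∞` (conjunct 4).
WHY (cell context).  The (117) VALUE member for `𝔊̃_k = G̃_k − G̃_kQ_k†(Q_kG̃_kQ_k†)⁻¹Q_kG̃_k − G̃_kD_UR_kD*_UG̃_k` is the SAME socket at `T := 𝔊̃_k` once the
middle and third words have GLOBAL value AND gradient rows; the gradient rows of those two words are STOREY H (R-ne9p1-g97-3).  This file is the first word,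
complete (value + gradient), and the template for the successor: swap `T`, add the rows.
HONEST SCOPE.  Norm bookkeeping BY NAME; `B` symbolic; the weights of (115) symbolic (print's multi-level `(L^jη)^{−α}` profile is NOT valued); `hposπ`, `hc₀`,
`hJ` and the MODEL letters stay DISPLAYED as in the globals; NOT the (117) bound for `𝔊` (first word only), NOT `B₀|J|_{(−3)}` with print's `B₀`; nothing of
[B11] (117)∕Prop. 4 or [B9] Thm 3.13 is asserted, valued or discharged.  NOT NE9 (cell pub-balaban: NE9 NOT PRINTED ∕ NOT PROVED; «NE9 ⇐ the named binders»; row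
WALLED ON A MODEL (O-NE9-1; #5 UNRULED); spine PROVED 0∕9; rung (B)+1 on a finite T⁴ — NOT infinite volume, NOT mass gap, NOT BetaPertH, NOT Clay; HONEST DEPENDENCY:
continuum YM on T⁴ ⇐ BetaPertH ∧ nine spine estimates (0/9 proved); BetaPertH ⇐ (D1) ∧ (D4) ∧ CAP+tail; G-an2-4 gates asym, D1 and NE2/3/4).  NEW file importing
`B9Eq347G1kPiSupGradGlobal` and `B11Eq117TransformationNormComp`; nothing modified.  Net new unproved facts: 0.
-/

noncomputable section

set_option autoImplicit false

open scoped InnerProductSpace ComplexConjugate BigOperators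

namespace Literature.MathematicalPhysics.QuantumFieldTheory.Balaban1983to89.B11Eq117GtildeTransformationNorm

open B4Sect5Torus (TSite)
open B9SectCLatticeCarrier (Bond bpos btgt unshift)
open B9Eq311L2Pairing (WL2)
open B9Eq33CovDerivVector (covGrad)
open B7Prop1Explicit (U1 Wcx boxVec)
open B11Eq103H1Complex (SiteL2K BondL2K covDerivL2K covDivL2K G1LatticeK)
open B9Eq310DeltaPrime (plaqHolU)
open B9Eq310HessianOperator (adTransportW)
open B9Eq315QTorus (perCfg cornerSite)
open B9Eq315QTower (towerP UlevOf)
open B9Eq326OperatorTower (laplaceAk)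
open B9Eq324DeltaPrimeATower (laplacePrimeAk)
open B9Eq3119DeltaPiTower (laplaceAkPi)
open B11Eq115Space (NegSup levWeight)
open B11Eq111FrakG (toCLM115)
open B11Eq117TransformationNormComp (norm_toCLM115_le_of_comp)
open B9Eq347G1kPiSupGradGlobal (exists_global_rows_G1kPi)

variable {d : ℕ} (hd : 1 ≤ d) (L : ℕ) [NeZero L] (hL : 1 ≤ L) (hL3 : 3 ≤ L)
  {𝔸 : Type*} [NormedRing 𝔸] [NormedAlgebra ℂ 𝔸] [CompleteSpace 𝔸] [NormOneClass 𝔸] [StarRing 𝔸] [NormedStarGroup 𝔸] [StarModule ℂ 𝔸]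
  {W : Type*} [NormedAddCommGroup W] [InnerProductSpace ℂ W] [FiniteDimensional ℂ W] (φ : W ≃ₗ[ℂ] 𝔸)
  {Mφ Mφ' : ℝ} (hMφ : 0 ≤ Mφ) (hMφ' : 0 ≤ Mφ') (hφ : ∀ w, ‖φ w‖ ≤ Mφ * ‖w‖) (hφ' : ∀ X, ‖φ.symm X‖ ≤ Mφ' * ‖X‖) (hstar : ∀ X : 𝔸, ‖star X‖ ≤ ‖X‖)
  {a : ℝ} (ha : 0 < a) {a' : ℝ} (ha' : 0 < a') {ϱ : ℝ} (hϱ0 : 0 ≤ ϱ) (hϱ1 : ϱ < 1)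
  (τ : 𝔸 →ₗ[ℂ] ℂ) {Cτ : ℝ} (hτ : ∀ X, ‖τ X‖ ≤ Cτ * ‖X‖) (hCτ : 0 ≤ Cτ) {Mτ : ℝ} (hτm : ∀ X Y : 𝔸, ‖τ (X * Y)‖ ≤ Mτ * ‖X‖ * ‖Y‖) (hMτ : 0 ≤ Mτ)
  {ρw : ℝ} (hρw : 0 ≤ ρw)
  (hτ₁ : ∀ X : 𝔸, τ (star X) = conj (τ X)) (hτ₂ : ∀ X Y : 𝔸, τ (X * Y) = τ (Y * X)) (hφτ : ∀ X Y : 𝔸, ⟪φ.symm X, φ.symm Y⟫_ℂ = τ (star X * Y))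
  (AQ : ℝ)

set_option maxHeartbeats 400000 in -- the ≈ 50-binder supplier + the (115) socket: the defeq assembly exceeds the default budget
include hd hL hL3 hMφ hMφ' hφ hφ' hstar ha ha' hϱ0 hϱ1 hτ hCτ hτm hMτ hρw hτ₁ hτ₂ hφτ in
/-- **THE (117) SOCKET FED FOR THE FIRST WORD `G̃_k` OF `𝔊̃_k` — `‖toCLM115 ∇_U G̃_k‖ ≤ max(w̄₀·B, w̄₁·B)·w̲⁻¹`, ONE height-free `B`**, for every height,
spacing on the diagonal, period, background of the MODEL letters in one window `α ≤ α₁` (four members), the positivity witnesses, print's weight, and ANY level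
functions ∕ weight parameters of (115). [cite: Balaban1985Variational, (117) p.295, (115) p.294; Balaban1985BackgroundPropagators, Thm 3.13 p.426, (3.130) p.421] -/
theorem exists_norm_toCLM115_G1kPi_le :
    ∃ α₁ B : ℝ, 0 < α₁ ∧ 0 ≤ B ∧
      ∀ (n : ℕ) (η : ℝ) (_hηL : η * (L : ℝ) ^ (n + 1) = 1) (c₀ c₁ : ℝ) [Fact (0 < c₀)] [Fact (0 < c₁)]
        (_hw : c₀ * ((L : ℝ) ^ (n + 1)) ^ d = c₁) (_hρ : |η| ^ d / c₀ ≤ ρw) (m : Fin d → ℕ) [∀ i, NeZero (m i)] (_hm : ∀ i, 1 ≤ m i)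
        (U : Bond d (towerP L m (n + 1)) → 𝔸ˣ) (αU : ℕ → ℝ) (_hα0 : ∀ j, 0 ≤ αU j) (hα1 : ∀ j, αU j ≤ 1 / 64)
        (hU1 : ∀ (j : ℕ) (x : B7Prop1Explicit.Site d) (k : Fin d), perCfg (towerP L m (j + 1)) (UlevOf L m (n + 1) U j) x k ∈ U1 𝔸)
        (hreg : ∀ (j : ℕ) (y : TSite d (towerP L m j)) (k : Fin d) (ρ' : Fin d → Fin L),
          ‖((Wcx L (perCfg (towerP L m (j + 1)) (UlevOf L m (n + 1) U j)) (cornerSite L y) k (boxVec L ρ') : 𝔸ˣ) : 𝔸) - 1‖ ≤ αU j)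
        (εU : ℕ → ℝ) (_hεU : ∀ j, 0 ≤ εU j) (_hUε : ∀ (j : ℕ) (b : Bond d (towerP L m (j + 1))), ‖(UlevOf L m (n + 1) U j b : 𝔸) - 1‖ ≤ εU j)
        (_hLb : ∀ (j : ℕ) (b : Bond d (towerP L m (j + 1))), UlevOf L m (n + 1) U j b ∈ U1 𝔸)
        (α : ℝ) (_hα : 0 ≤ α) (_hαle : α ≤ α₁)
        (hUst : ∀ b, star (U b : 𝔸) = (((U b)⁻¹ : 𝔸ˣ) : 𝔸)) (_hUb : ∀ b, U b ∈ U1 𝔸) (_hUη : ∀ b, ‖(U b : 𝔸) - 1‖ ≤ α * η)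
        (_hpl : ∀ p : B9SectCLatticeCarrier.Plaq d (towerP L m (n + 1)), ‖(plaqHolU U p : 𝔸) - 1‖ ≤ α * η ^ 2)
        (_hUgrad : ∀ (x : TSite d (towerP L m (n + 1))) (μ : Fin d), ‖(U (x, μ) : 𝔸) - U (unshift μ x, μ)‖ ≤ α * η ^ 2)
        (_hRlev : ∀ (j : ℕ) (b : Bond d (towerP L m (j + 1))) (w : W), ‖adTransportW φ (UlevOf L m (n + 1) U j) b w‖ ≤ ‖w‖)
        (_hεg : ∀ j < n + 1, εU j ≤ α * ϱ ^ j) (_hAQ : ∑ j ∈ Finset.range (n + 1), αU j ≤ AQ)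
        (hpos' : ∀ x : SiteL2K ℂ d (towerP L m (n + 1)) c₀ W, x ≠ 0 → 0 < RCLike.re ⟪x, laplacePrimeAk L m n φ η U a' (c₁ := c₁) x⟫_ℂ)
        (hpos : ∀ x : BondL2K ℂ d (towerP L m (n + 1)) c₀ W, x ≠ 0 →
          0 < RCLike.re ⟪x, laplaceAk L m n φ η U hL αU hα1 hU1 hreg τ (c₀ := c₀) (c₁ := c₁) a x⟫_ℂ)
        (hposπ : ∀ x : BondL2K ℂ d (towerP L m (n + 1)) c₀ W, x ≠ 0 →
          0 < RCLike.re ⟪x, laplaceAkPi L m n φ τ η U a' hpos' hL αU hα1 hU1 hreg (c₁ := c₁) a x⟫_ℂ)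
        (_hc₀ : c₀ = η ^ d)
        (_hJ : ∀ (μ : Fin d) (y : TSite d (towerP L m (n + 1))),
          ‖B9Eq39Adjoint.J (fun μ => B9Eq33CovDerivVector.shiftEquiv μ) (fun μ y => U (y, μ)) η μ y‖ ≤ α)
        (Lw ηw : ℝ) [Fact (0 < Lw)] [Fact (0 < ηw)] (lev₀ : Bond d (towerP L m (n + 1)) → ℕ) (lev₁ : Bond d (towerP L m (n + 1)) × Fin d → ℕ),
        ‖toCLM115 (L := Lw) (η := ηw) (lev₀ := lev₀) lev₁ (covGrad ((η : ℂ))⁻¹ (adTransportW φ U))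
            ((WL2.linearEquiv ℂ ℂ (fun _ : Bond d (towerP L m (n + 1)) => c₀)).toLinearMap ∘ₗ (G1LatticeK hposπ : _ →ₗ[ℂ] _) ∘ₗ
              ((WL2.linearEquiv ℂ ℂ (fun _ : Bond d (towerP L m (n + 1)) => c₀)).symm.toLinearMap :
                (Bond d (towerP L m (n + 1)) → W) →ₗ[ℂ] BondL2K ℂ d (towerP L m (n + 1)) c₀ W))‖ ≤
          max ((NegSup.wSup (levWeight Lw ηw lev₀ 1) : ℝ) * B) (NegSup.wSup (levWeight Lw ηw lev₁ 2) * B) *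
            NegSup.wInvSup (levWeight Lw ηw lev₀ 3) := by
  classical
  obtain ⟨α₁, B, hα₁, hB, HG⟩ := exists_global_rows_G1kPi hd L hL hL3 φ hMφ hMφ' hφ hφ' hstar ha ha' hϱ0 hϱ1 τ hτ hCτ hτm hMτ hρw hτ₁ hτ₂ hφτ AQ
  refine ⟨α₁, B, hα₁, hB, ?_⟩
  intro n η hηL c₀ c₁ _ _ hw hρ m _ hm U αU hα0 hα1 hU1 hreg εU hεU hUε hLb α hα hαle hUst hUb hUη hpl hUgrad hRlev hεg hAQ hpos' hpos hposπ hc₀ hJ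
    Lw ηw _ _ lev₀ lev₁
  have Hk := HG n η hηL c₀ c₁ hw hρ m hm U αU hα0 hα1 hU1 hreg εU hεU hUε hLb α hα hαle hUst hUb hUη hpl hUgrad hRlev hεg hAQ hpos' hpos hposπ hc₀ hJ
  -- the transformation read on plain bond functions
  have hT : ∀ (g : Bond d (towerP L m (n + 1)) → W) (x : Bond d (towerP L m (n + 1))),
      ((WL2.linearEquiv ℂ ℂ (fun _ : Bond d (towerP L m (n + 1)) => c₀)).toLinearMap ∘ₗ (G1LatticeK hposπ : _ →ₗ[ℂ] _) ∘ₗ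
        ((WL2.linearEquiv ℂ ℂ (fun _ : Bond d (towerP L m (n + 1)) => c₀)).symm.toLinearMap :
          (Bond d (towerP L m (n + 1)) → W) →ₗ[ℂ] BondL2K ℂ d (towerP L m (n + 1)) c₀ W)) g x =
        WL2.equiv ℂ (fun _ : Bond d (towerP L m (n + 1)) => c₀) W
          (G1LatticeK hposπ ((WL2.equiv ℂ (fun _ : Bond d (towerP L m (n + 1)) => c₀) W).symm g)) x := fun _ _ => rfl
  have hgM : ∀ (g : Bond d (towerP L m (n + 1)) → W) (b : Bond d (towerP L m (n + 1))),
      ‖WL2.equiv ℂ (fun _ : Bond d (towerP L m (n + 1)) => c₀) W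
        ((WL2.equiv ℂ (fun _ : Bond d (towerP L m (n + 1)) => c₀) W).symm g) b‖ ≤ ‖g‖ := fun g b => by
    rw [Equiv.apply_symm_apply]; exact norm_le_pi_norm g b
  refine norm_toCLM115_le_of_comp lev₁ _ _ hB hB (fun g => ?_) (fun g => ?_)
  · refine (pi_norm_le_iff_of_nonneg (mul_nonneg hB (norm_nonneg g))).2 fun x => ?_
    rw [hT]
    exact (Hk ((WL2.equiv ℂ (fun _ : Bond d (towerP L m (n + 1)) => c₀) W).symm g) ‖g‖ (norm_nonneg g) (hgM g) ⟨0, hd⟩ x (bpos x)).1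
  · refine (pi_norm_le_iff_of_nonneg (mul_nonneg hB (norm_nonneg g))).2 fun bμ => ?_
    obtain ⟨b, μ⟩ := bμ
    have e : (((WL2.linearEquiv ℂ ℂ (fun _ : Bond d (towerP L m (n + 1)) => c₀)).toLinearMap ∘ₗ (G1LatticeK hposπ : _ →ₗ[ℂ] _) ∘ₗ
        ((WL2.linearEquiv ℂ ℂ (fun _ : Bond d (towerP L m (n + 1)) => c₀)).symm.toLinearMap :
          (Bond d (towerP L m (n + 1)) → W) →ₗ[ℂ] BondL2K ℂ d (towerP L m (n + 1)) c₀ W)) g : Bond d (towerP L m (n + 1)) → W) =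
        WL2.equiv ℂ (fun _ : Bond d (towerP L m (n + 1)) => c₀) W
          (G1LatticeK hposπ ((WL2.equiv ℂ (fun _ : Bond d (towerP L m (n + 1)) => c₀) W).symm g)) := funext (hT g)
    rw [e]
    exact (Hk ((WL2.equiv ℂ (fun _ : Bond d (towerP L m (n + 1)) => c₀) W).symm g) ‖g‖ (norm_nonneg g) (hgM g) μ b (bpos b)).2.2.2

end Literature.MathematicalPhysics.QuantumFieldTheory.Balaban1983to89.B11Eq117GtildeTransformationNorm

end
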